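import Literature.IUT.HodgeTheaters.Cor53iArithHratOfMonoidRigidity
import Literature.IUT.HodgeTheaters.Cor53RigidOverBaseOfRatioRigidity
import HarnessLib

/-!
# [IUTchI] Cor 5.3 (i): `hker` at ANY model `ℱ(Δ)` of global divisor data from [FrdI] Cor 4.11 (iii)/(iv), Φ-rigidity and
# the Ex 5.1 (v) unit-ratio law — the R81 engine made GENERIC in `Δ : GlobalDivisorData G`

S. Mochizuki, *Inter-universal Teichmüller theory I*, kurims manuscript (May 2020), §5 Cor 5.3 (i) p. 144 l. 2–11 and its proof
l. 24–33; Ex 5.1 (ii)/(iii) pp. 125–126, (v)/(vi) pp. 127–130 ([IUTchI] Cor 5.3 (i) p.144) [claim: Mochizuki2012, status: disputed]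
(nothing of the series is asserted; no side taken on [IUTchIII] Cor. 3.12); [FrdI] Thm 5.2 (i) p. 100, Cor 4.11 pp. 91–92
[cite: MochizukiFrdI2008, Thm. 5.2(i) p.100].

PROOF-ONLY (cell abc-iut, seat abc-iut-L5-t11 gen 16, row «C53I-FCIRC-HKER», abc-iut-L5-lead RULINGS #154 (2b)).  This seat's
R81 files ★ `Cor53iArithDivThroughAutOfCor411` / ★ `Cor53iArithHratOfMonoidRigidity` proved `hker⊛` at THE arithmetic model
`ℱ^⊛(†𝒟^⊚) = ℱ(GlobalDivisorData.arith F)`; the `⊚` twin lives at the base-changed models `ℱ(Φ ∘ S, 𝔹 ∘ S, Div ∘ S)` over `ℬ(H)⁰`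
([FrdI] Prop 1.6).  Rather than replaying the engine textually, this file proves it ONCE for an arbitrary
`Δ : GlobalDivisorData G`, with the model-specific inputs displayed as hypotheses that abc-iut-w4-d109's / this seat's
[FrdI] Cor 4.11 files discharge at each carrier:
* `hdeg` — every self-equivalence preserves `deg_Fr` ([FrdI] Cor 4.11 (iii));
* `hrig` — `Ψ ⋙ Base` is rigid ([FrdI] Cor 4.11 (ii), slim base), whence §0 `model_overBase_iso_unique`;
* `hdivAut` — zero divisors of a self-equivalence over the identity move through a natural automorphism `θ_Ψ` of `Φ` and a
  base identification `η'` ([FrdI] Cor 4.11 (iv) + the `1`-uniqueness of the base square: §0 `model_exists_divAut_of_overBase`);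
* `hunits` — `𝔹` is group-like ([FrdI] Thm 5.2 hypotheses);
* `hΦ` — Φ-RIGID-PRINC (a monoid automorphism of `Φ(A)` whose extension to `Φ(A)^gp` fixes all principal divisors is `1`;
  classical for arithmetic divisors, abc-iut-L5-t1 R82 ★ `EffArithDivisor.mulEquiv_apply_eq_self_of_map_principal`);
* `hB` — 𝔹-RATIO, print's Ex 5.1 (v) unit-ratio law (FACT-SHAPE ≙ F-2577; displayed, never proved here).
§ A `Cor53.model_divAut_fixes_divB_of_ratio` is the [FrdI] Thm 5.2 (i) bookkeeping verbatim from R81; § B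
**`Cor53.model_rigidOverBase_of_divMonoidRigid_of_ratioRigid`** feeds abc-iut-L5-t4's generic (k0)
`Cor53.rigidOverBase_of_ratioRigid` (★ `Cor53RigidOverBaseOfRatioRigidity`), with the §0 descend corollaries.
HONEST TAGS: `hB`, `hlift` displayed, not proved; no token moves on this file alone; typed ≠ proved; nothing here asserts abc
proved or refuted.  Default heartbeats throughout (the generic `Δ` elaborates where the unfolded arithmetic model needed 2×).
-/

noncomputable section

set_option backward.isDefEq.respectTransparency false

namespace Literature.IUT.HodgeTheaters

open CategoryTheory Opposite Literature.AlgebraicGeometry.Frobenioids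
open Literature.AlgebraicGeometry.Frobenioids.PreFrobenioid

universe u

/-! ### §0. Base identifications are unique; zero divisors move through an automorphism of `Φ` over `𝟭` -/

namespace GlobalDivisorData

variable {G : ProfiniteGrp.{u}} (Δ : GlobalDivisorData G)

/-- **The base identification of a self-equivalence of `ℱ(Δ)` over the identity of `ℬ(G)⁰` is UNIQUE** whenever `Ψ ⋙ Base` is
rigid ([FrdI] Cor 4.11 (ii) over a slim base): any two `η₁ η₂ : Ψ ⋙ Base ≅ Base` coincide. ([IUTchI] Ex 5.1 (iii) p.125)
[cite: MochizukiFrdI2008, Cor. 4.11 (ii) p.91] [claim: Mochizuki2012, status: disputed] -/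
theorem model_overBase_iso_unique (Ψ : Δ.ModelGlobalFrobenioid ≌ Δ.ModelGlobalFrobenioid)
    (hrig : IsRigidFunctor (Ψ.functor ⋙ Δ.modelBase)) (η₁ η₂ : Ψ.functor ⋙ Δ.modelBase ≅ Δ.modelBase) : η₁ = η₂ := by
  have h := hrig (η₁ ≪≫ η₂.symm)
  calc η₁ = (η₁ ≪≫ η₂.symm) ≪≫ η₂ := by rw [Iso.trans_assoc, Iso.symm_self_id, Iso.trans_refl]
    _ = η₂ := by rw [h, Iso.refl_trans]

/-- **[FrdI] Cor 4.11 (iv) for a self-equivalence OVER THE IDENTITY of `ℬ(G)⁰`: zero divisors move through a NATURAL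
AUTOMORPHISM `θ_Ψ` of `Φ` over `𝟭` and a base identification `η'`.**  Given Cor 4.11 (iv) data `(ΨBase, Ψ^Φ = E', η)` whose
base square is `1`-unique and `Ψ ⋙ Base ≅ Base`, the `1`-uniqueness gives `ε : 𝟭 ≅ ΨBase`; `θ := ε^* ∘ Ψ^Φ`
(`exists_transport_along_iso`), `η' := η · Base(ε⁻¹)`, and `Div(Ψ φ) = η'_A^* θ_{Base A}(Div φ)` for all `φ : A → B`.
([IUTchI] Cor 5.3 (i) p.144) [cite: MochizukiFrdI2008, Cor. 4.11 (iv) p.92] [claim: Mochizuki2012, status: disputed] -/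
theorem model_exists_divAut_of_overBase (Ψ : Δ.ModelGlobalFrobenioid ≌ Δ.ModelGlobalFrobenioid)
    {ΨBase : BaseCat G ⥤ BaseCat G}
    (E' : (ModelFrobenioid.data Δ.Φ Δ.B Δ.div).DivisorMonoidIsoOverBase (ModelFrobenioid.data Δ.Φ Δ.B Δ.div) ΨBase)
    (η : Ψ.functor ⋙ Δ.modelBase ≅ Δ.modelBase ⋙ ΨBase)
    (hsq : PreFrobenioidData.OneUniqueSquare Ψ.functor Δ.modelBase Δ.modelBase ΨBase)
    (hdivE : ∀ ⦃A B : Δ.ModelGlobalFrobenioid⦄ (φ : A ⟶ B),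
      ModelFrobenioid.div (Ψ.functor.map φ) = pull Δ.Φ (η.hom.app A) (E'.iso A.base (ModelFrobenioid.div φ)))
    (h : Nonempty (Ψ.functor ⋙ Δ.modelBase ≅ Δ.modelBase)) :
    ∃ (θ : (ModelFrobenioid.data Δ.Φ Δ.B Δ.div).DivisorMonoidIsoOverBase (ModelFrobenioid.data Δ.Φ Δ.B Δ.div) (𝟭 (BaseCat G)))
      (η' : Ψ.functor ⋙ Δ.modelBase ≅ Δ.modelBase),
      ∀ ⦃A B : Δ.ModelGlobalFrobenioid⦄ (φ : A ⟶ B),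
        ModelFrobenioid.div (Ψ.functor.map φ) = pull Δ.Φ (η'.hom.app A) (θ.iso A.base (ModelFrobenioid.div φ)) := by
  obtain ⟨h⟩ := h
  -- the `1`-uniqueness of the base square: `ΨBase ≅ 𝟭`
  obtain ⟨ε⟩ := hsq.2.2 (𝟭 _) ⟨h ≪≫ (Functor.rightUnitor _).symm⟩
  obtain ⟨θ, hθ⟩ := PreFrobenioidData.DivisorMonoidIsoOverBase.exists_transport_along_iso _ E' ε
  refine ⟨θ, η ≪≫ Functor.isoWhiskerLeft Δ.modelBase ε.symm ≪≫ Δ.modelBase.rightUnitor, fun A B φ => ?_⟩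
  rw [hdivE φ, hθ]
  simp only [Iso.trans_hom, NatTrans.comp_app, Functor.isoWhiskerLeft_hom, Functor.whiskerLeft_app, Iso.symm_hom,
    Functor.rightUnitor_hom_app]
  rw [Literature.AlgebraicGeometry.Frobenioids.pull_comp]
  congr 1
  change _ = Literature.AlgebraicGeometry.Frobenioids.pull Δ.Φ (ε.inv.app A.base)
    (Literature.AlgebraicGeometry.Frobenioids.pull Δ.Φ (ε.hom.app A.base) (E'.iso A.base (ModelFrobenioid.div φ)))
  rw [← Literature.AlgebraicGeometry.Frobenioids.pull_comp, ε.inv_hom_id_app,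
    Literature.AlgebraicGeometry.Frobenioids.pull_id]

end GlobalDivisorData

namespace Cor53

section Model

variable {G : ProfiniteGrp.{u}} (Δ : GlobalDivisorData G)

/-! ### § A. (hratio) makes the divisor automorphism `θ_Ψ` fix every principal divisor -/

/-- **(hratio) ⇒ `θ_Ψ` fixes principal divisors** ([FrdI] Thm 5.2 (i) bookkeeping at ANY model `ℱ(Δ)` over `ℬ(G)⁰`).  Let `Ψ`
be a `deg_Fr`-preserving self-equivalence with `Div(Ψ φ) = η'_X^* θ_{Base X}(Div φ)` for all `φ` (file 1's `(θ, η')`) which preserves through `η'`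
the birational units of parallel linear arrows.  Then `θ_A^gp(Div_B w) = Div_B w` for every `A` and every `w ∈ 𝔹(A)`:
write `Div_B w · of b = of a` in `Φ^⊛(A)^gp`; the arrows `f = (1, 𝟙, a, w)` and `g = (1, 𝟙, b, 1)` from `(A, 0)` to
`(A, of b)` are parallel and linear; relations (d) for `Ψ f`, `Ψ g` (same base arrow by naturality of `η'`, `deg_Fr = 1`
by [FrdI] Cor 4.11 (iii)) give `of Div(Ψ f) · Div_B u_{Ψ g} = of Div(Ψ g) · Div_B u_{Ψ f}`; (hratio) gives
`u_{Ψ f} = u_{Ψ g} · η'^* w`; naturality of `Div_B` and injectivity of `η'_X^*` conclude.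
([IUTchI] Cor 5.3 (i) p.144) [cite: MochizukiFrdI2008, Thm. 5.2(i) p.100] [claim: Mochizuki2012, status: disputed] -/
theorem model_divAut_fixes_divB_of_ratio
    (Ψ : Δ.ModelGlobalFrobenioid ≌ Δ.ModelGlobalFrobenioid)
    (θ : (ModelFrobenioid.data Δ.Φ Δ.B Δ.div).DivisorMonoidIsoOverBase
        (ModelFrobenioid.data Δ.Φ Δ.B Δ.div)
        (𝟭 (BaseCat G)))
    (η' : Ψ.functor ⋙ Δ.modelBase ≅ Δ.modelBase)
    (hdeg : PreFrobenioidData.PreservesDegFr (ModelFrobenioid.data Δ.Φ Δ.B Δ.div) (ModelFrobenioid.data Δ.Φ Δ.B Δ.div) Ψ)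
    (hdivθ : ∀ ⦃X Y : Δ.ModelGlobalFrobenioid⦄ (φ : X ⟶ Y),
      ModelFrobenioid.div (Ψ.functor.map φ) =
        pull Δ.Φ (A := X.base) (B := (Ψ.functor.obj X).base) (η'.hom.app X)
          (θ.iso X.base (ModelFrobenioid.div φ)))
    (hratio : ∀ ⦃X Y : Δ.ModelGlobalFrobenioid⦄ (f g : X ⟶ Y), ModelFrobenioid.degFr f = 1 →
      ModelFrobenioid.degFr g = 1 → ModelFrobenioid.baseMap f = ModelFrobenioid.baseMap g →
        ModelFrobenioid.unit (Ψ.functor.map f) *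
            pull Δ.B (A := X.base) (B := (Ψ.functor.obj X).base) (η'.hom.app X)
              (ModelFrobenioid.unit g) =
          ModelFrobenioid.unit (Ψ.functor.map g) *
            pull Δ.B (A := X.base) (B := (Ψ.functor.obj X).base) (η'.hom.app X)
              (ModelFrobenioid.unit f)) :
    ∀ (A : BaseCat G) (w : Δ.B.obj (op A)),
      MonGp.map (MulEquiv.toMonoidHom (M := Δ.Φ.obj (op A))
          (N := Δ.Φ.obj (op A)) (θ.iso A))
          (divB Δ.Φ Δ.B Δ.div (op A) w) =
        divB Δ.Φ Δ.B Δ.div (op A) w := by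
  intro A w
  -- `Div_B w · of b = of a` in `Φ^⊛(A)^gp`
  obtain ⟨⟨a, ⟨b, hb⟩⟩, hab⟩ :=
    (Localization.monoidOf (⊤ : Submonoid (Δ.Φ.obj (op A)))).surj
      (divB Δ.Φ Δ.B Δ.div (op A) w)
  have hab' : divB Δ.Φ Δ.B Δ.div (op A) w *
      Algebra.GrothendieckGroup.of b = Algebra.GrothendieckGroup.of a := hab
  -- the two parallel linear arrows `f = (1, 𝟙, a, w)`, `g = (1, 𝟙, b, 1)` from `(A, 0)` to `(A, of b)`
  let X : Δ.ModelGlobalFrobenioid := ⟨A, 1⟩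
  let Y : Δ.ModelGlobalFrobenioid := ⟨A, Algebra.GrothendieckGroup.of b⟩
  let g : X ⟶ Y :=
    { degFr := 1
      base := 𝟙 A
      div := b
      unit := 1
      rel := by
        show (1 : Algebra.GrothendieckGroup (Δ.Φ.obj (op A))) ^ ((1 : ℕ+) : ℕ) *
            Algebra.GrothendieckGroup.of b =
          pullGp Δ.Φ (𝟙 A) (Algebra.GrothendieckGroup.of b) *
            divB Δ.Φ Δ.B Δ.div (op A) 1
        rw [PNat.one_coe, pow_one, one_mul, pullGp_id, map_one, mul_one] }
  let f : X ⟶ Y :=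
    { degFr := 1
      base := 𝟙 A
      div := a
      unit := w
      rel := by
        show (1 : Algebra.GrothendieckGroup (Δ.Φ.obj (op A))) ^ ((1 : ℕ+) : ℕ) *
            Algebra.GrothendieckGroup.of a =
          pullGp Δ.Φ (𝟙 A) (Algebra.GrothendieckGroup.of b) *
            divB Δ.Φ Δ.B Δ.div (op A) w
        rw [PNat.one_coe, pow_one, one_mul, pullGp_id, mul_comm]
        exact hab'.symm }
  -- Frobenius degrees of `Ψ f`, `Ψ g` (`hdeg` = [FrdI] Cor 4.11 (iii))
  have hdeg_f : ModelFrobenioid.degFr (Ψ.functor.map f) = 1 := hdeg f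
  have hdeg_g : ModelFrobenioid.degFr (Ψ.functor.map g) = 1 := hdeg g
  -- `Base(Ψ f) = Base(Ψ g)` by the naturality of `η'` (both lie over `𝟙 A`)
  have hbase : ModelFrobenioid.baseMap (Ψ.functor.map f) = ModelFrobenioid.baseMap (Ψ.functor.map g) := by
    have nf := η'.hom.naturality f
    have ng := η'.hom.naturality g
    have hfg : (Ψ.functor ⋙ Δ.modelBase).map f =
        (Ψ.functor ⋙ Δ.modelBase).map g := by
      rw [← cancel_mono (η'.hom.app Y), nf, ng]
      rfl
    exact hfg
  -- relations (d) of `Ψ f`, `Ψ g`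
  have ef := ModelFrobenioid.rel (Ψ.functor.map f)
  have eg := ModelFrobenioid.rel (Ψ.functor.map g)
  rw [hdeg_f, PNat.one_coe, pow_one] at ef
  rw [hdeg_g, PNat.one_coe, pow_one, ← hbase] at eg
  have key : Algebra.GrothendieckGroup.of (ModelFrobenioid.div (Ψ.functor.map f)) *
        divB _ _ Δ.div _ (ModelFrobenioid.unit (Ψ.functor.map g)) =
      Algebra.GrothendieckGroup.of (ModelFrobenioid.div (Ψ.functor.map g)) *
        divB _ _ Δ.div _ (ModelFrobenioid.unit (Ψ.functor.map f)) := by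
    have h2 : (Ψ.functor.obj X).cls * (Algebra.GrothendieckGroup.of (ModelFrobenioid.div (Ψ.functor.map f)) *
          divB _ _ Δ.div _ (ModelFrobenioid.unit (Ψ.functor.map g))) =
        (Ψ.functor.obj X).cls * (Algebra.GrothendieckGroup.of (ModelFrobenioid.div (Ψ.functor.map g)) *
          divB _ _ Δ.div _ (ModelFrobenioid.unit (Ψ.functor.map f))) := by
      rw [← mul_assoc, ef, ← mul_assoc, eg, mul_right_comm]
    exact mul_left_cancel h2
  -- (hratio) for `f`, `g`: `u_{Ψ f} = u_{Ψ g} · η'^* w`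
  have hr := hratio f g rfl rfl rfl
  have hug : ModelFrobenioid.unit g = 1 := rfl
  have huf : ModelFrobenioid.unit f = w := rfl
  rw [hug, map_one, mul_one, huf] at hr
  -- `Div_B (η'^* w) = η'^* Div_B w` (naturality of `Div_B`)
  have hdivB : divB _ _ Δ.div _ (ModelFrobenioid.unit (Ψ.functor.map f)) =
      divB _ _ Δ.div _ (ModelFrobenioid.unit (Ψ.functor.map g)) *
        pullGp Δ.Φ (X := (Ψ.functor.obj X).base) (Y := X.base) (η'.hom.app X)
          (divB Δ.Φ Δ.B Δ.div (op A) w) := by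
    rw [hr, map_mul, pullGp_divB]
    rfl
  rw [hdivB, ← mul_assoc] at key
  have key2 : Algebra.GrothendieckGroup.of (ModelFrobenioid.div (Ψ.functor.map f)) =
      Algebra.GrothendieckGroup.of (ModelFrobenioid.div (Ψ.functor.map g)) *
        pullGp Δ.Φ (X := (Ψ.functor.obj X).base) (Y := X.base) (η'.hom.app X)
          (divB Δ.Φ Δ.B Δ.div (op A) w) := by
    rw [mul_right_comm] at key
    exact mul_right_cancel key
  -- zero divisors of `Ψ f`, `Ψ g` through `(θ, η')`
  have hdf : ModelFrobenioid.div (Ψ.functor.map f) =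
      pull Δ.Φ (A := X.base) (B := (Ψ.functor.obj X).base) (η'.hom.app X) (θ.iso A a) :=
    hdivθ f
  have hdg : ModelFrobenioid.div (Ψ.functor.map g) =
      pull Δ.Φ (A := X.base) (B := (Ψ.functor.obj X).base) (η'.hom.app X) (θ.iso A b) :=
    hdivθ g
  rw [hdf, hdg, of_pull_eq_pullGp_of, of_pull_eq_pullGp_of, ← map_mul] at key2
  -- pull-back along the isomorphism `η'_X` is injective
  have key3 : Algebra.GrothendieckGroup.of (M := Δ.Φ.obj (op A)) (θ.iso A a) =
      Algebra.GrothendieckGroup.of (M := Δ.Φ.obj (op A)) (θ.iso A b) *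
        divB Δ.Φ Δ.B Δ.div (op A) w :=
    pullGp_injective_of_iso Δ.Φ (η'.app X) key2
  -- conclude: `θ^gp (Div_B w) = θ^gp (of a / of b) = of (θ a) / of (θ b) = Div_B w`
  have hw : divB Δ.Φ Δ.B Δ.div (op A) w =
      Algebra.GrothendieckGroup.of a * (Algebra.GrothendieckGroup.of b)⁻¹ :=
    eq_mul_inv_of_mul_eq hab'
  have h1 : MonGp.map (MulEquiv.toMonoidHom (M := Δ.Φ.obj (op A))
        (N := Δ.Φ.obj (op A)) (θ.iso A)) (Algebra.GrothendieckGroup.of a) =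
      Algebra.GrothendieckGroup.of (M := Δ.Φ.obj (op A)) (θ.iso A a) :=
    MonGp.map_of _ a
  have h2 : MonGp.map (MulEquiv.toMonoidHom (M := Δ.Φ.obj (op A))
        (N := Δ.Φ.obj (op A)) (θ.iso A)) (Algebra.GrothendieckGroup.of b) =
      Algebra.GrothendieckGroup.of (M := Δ.Φ.obj (op A)) (θ.iso A b) :=
    MonGp.map_of _ b
  have s1 : MonGp.map (MulEquiv.toMonoidHom (M := Δ.Φ.obj (op A)) (N := Δ.Φ.obj (op A)) (θ.iso A)) (Algebra.GrothendieckGroup.of a) * (MonGp.map (MulEquiv.toMonoidHom (M := Δ.Φ.obj (op A)) (N := Δ.Φ.obj (op A)) (θ.iso A)) (Algebra.GrothendieckGroup.of b))⁻¹ =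
      Algebra.GrothendieckGroup.of (M := Δ.Φ.obj (op A)) (θ.iso A a) * (Algebra.GrothendieckGroup.of (M := Δ.Φ.obj (op A)) (θ.iso A b))⁻¹ :=
    congrArg₂ (fun x y => x * y⁻¹) h1 h2
  have s2 : Algebra.GrothendieckGroup.of (M := Δ.Φ.obj (op A)) (θ.iso A a) * (Algebra.GrothendieckGroup.of (M := Δ.Φ.obj (op A)) (θ.iso A b))⁻¹ =
      Algebra.GrothendieckGroup.of (M := Δ.Φ.obj (op A)) (θ.iso A b) * divB Δ.Φ Δ.B Δ.div (op A) w * (Algebra.GrothendieckGroup.of (M := Δ.Φ.obj (op A)) (θ.iso A b))⁻¹ :=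
    congrArg (· * (Algebra.GrothendieckGroup.of (M := Δ.Φ.obj (op A)) (θ.iso A b))⁻¹) key3
  have s3 : Algebra.GrothendieckGroup.of (M := Δ.Φ.obj (op A)) (θ.iso A b) * divB Δ.Φ Δ.B Δ.div (op A) w * (Algebra.GrothendieckGroup.of (M := Δ.Φ.obj (op A)) (θ.iso A b))⁻¹ = divB Δ.Φ Δ.B Δ.div (op A) w :=
    mul_inv_cancel_comm _ _
  rw [hw, map_mul, map_inv]
  exact s1.trans (s2.trans (s3.trans hw))

/-! ### § B. `hker` at `ℱ(Δ)` from the displayed model inputs -/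

/-- **[IUTchI] Cor 5.3 (i), injectivity content at ANY model `ℱ(Δ)` — `RigidOverBase Δ.modelBase` (`hker`) — from the [FrdI]
Cor 4.11 package (`hdeg`, `hrig`, `hdivAut`), group-like `𝔹` (`hunits`), Φ-RIGID-PRINC (`hΦ`) and 𝔹-RATIO (`hB`, Ex 5.1 (v),
FACT-SHAPE).**  PROOF: for `Ψ` over the identity take `(θ, η')` from `hdivAut`; `hB`'s identification IS `η'`
(`model_overBase_iso_unique`); § A makes `θ^gp` fix principal divisors, `hΦ` makes `θ = 1`, so (hdiv) holds through `η'`; then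
abc-iut-L5-t4's (k0) `Cor53.rigidOverBase_of_ratioRigid`. ([IUTchI] Cor 5.3 (i) p.144) [claim: Mochizuki2012, status: disputed] -/
theorem model_rigidOverBase_of_divMonoidRigid_of_ratioRigid
    (hunits : ∀ (A : (BaseCat G)ᵒᵖ) (b : Δ.B.obj A), IsUnit b)
    (hdeg : ∀ Ψ : Δ.ModelGlobalFrobenioid ≌ Δ.ModelGlobalFrobenioid,
      PreFrobenioidData.PreservesDegFr (ModelFrobenioid.data Δ.Φ Δ.B Δ.div) (ModelFrobenioid.data Δ.Φ Δ.B Δ.div) Ψ)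
    (hrig : ∀ Ψ : Δ.ModelGlobalFrobenioid ≌ Δ.ModelGlobalFrobenioid, IsRigidFunctor (Ψ.functor ⋙ Δ.modelBase))
    (hdivAut : ∀ Ψ : Δ.ModelGlobalFrobenioid ≌ Δ.ModelGlobalFrobenioid,
      Nonempty (Ψ.functor ⋙ Δ.modelBase ≅ Δ.modelBase) →
      ∃ (θ : (ModelFrobenioid.data Δ.Φ Δ.B Δ.div).DivisorMonoidIsoOverBase (ModelFrobenioid.data Δ.Φ Δ.B Δ.div) (𝟭 (BaseCat G)))
        (η' : Ψ.functor ⋙ Δ.modelBase ≅ Δ.modelBase),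
        ∀ ⦃A B : Δ.ModelGlobalFrobenioid⦄ (φ : A ⟶ B),
          ModelFrobenioid.div (Ψ.functor.map φ) = pull Δ.Φ (η'.hom.app A) (θ.iso A.base (ModelFrobenioid.div φ)))
    (hΦ : ∀ (A : BaseCat G) (θ : Δ.Φ.obj (op A) ≃* Δ.Φ.obj (op A)),
      (∀ w : Δ.B.obj (op A), MonGp.map θ.toMonoidHom (divB Δ.Φ Δ.B Δ.div (op A) w) = divB Δ.Φ Δ.B Δ.div (op A) w) →
      ∀ x, θ x = x)
    (hB : ∀ Ψ : Δ.ModelGlobalFrobenioid ≌ Δ.ModelGlobalFrobenioid,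
      Nonempty (Ψ.functor ⋙ Δ.modelBase ≅ Δ.modelBase) →
      ∃ η : Ψ.functor ⋙ Δ.modelBase ≅ Δ.modelBase,
        ∀ ⦃X Y : Δ.ModelGlobalFrobenioid⦄ (f g : X ⟶ Y), ModelFrobenioid.degFr f = 1 →
          ModelFrobenioid.degFr g = 1 → ModelFrobenioid.baseMap f = ModelFrobenioid.baseMap g →
            ModelFrobenioid.unit (Ψ.functor.map f) *
                pull Δ.B (A := X.base) (B := (Ψ.functor.obj X).base) (η.hom.app X)
                  (ModelFrobenioid.unit g) =
              ModelFrobenioid.unit (Ψ.functor.map g) *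
                pull Δ.B (A := X.base) (B := (Ψ.functor.obj X).base) (η.hom.app X)
                  (ModelFrobenioid.unit f)) :
    CatIsomorphism.RigidOverBase Δ.modelBase := by
  refine rigidOverBase_of_ratioRigid (DivB := Δ.div) hunits fun Ψ hΨ => ?_
  obtain ⟨θ, η', hdivθ⟩ := hdivAut Ψ hΨ
  obtain ⟨η, hratio⟩ := hB Ψ hΨ
  obtain rfl : η = η' := GlobalDivisorData.model_overBase_iso_unique Δ Ψ (hrig Ψ) η η'
  have hfix := model_divAut_fixes_divB_of_ratio Δ Ψ θ η (hdeg Ψ) hdivθ hratio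
  have hθ : ∀ (A : BaseCat G) (x : Δ.Φ.obj (op A)), θ.iso A x = x := fun A => hΦ A (θ.iso A) (hfix A)
  refine ⟨η, fun X Y φ => hdeg Ψ φ, fun X Y φ => ?_, hratio⟩
  rw [hdivθ φ, hθ]

/-- **[IUTchI] Cor 5.3 (i), INJECTIVITY of `Aut(ℱ(Δ)) → Aut(ℬ(G)⁰)`** (the §0 natural map `CatIsomorphism.descend he hu`) from the
same displayed inputs. ([IUTchI] Cor 5.3 (i) p.144) [claim: Mochizuki2012, status: disputed] -/
theorem model_descend_injective_of_divMonoidRigid_of_ratioRigid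
    (he : CatIsomorphism.HasUnder Δ.modelBase Δ.modelBase) (hu : CatIsomorphism.UnderUnique Δ.modelBase Δ.modelBase)
    (hunits : ∀ (A : (BaseCat G)ᵒᵖ) (b : Δ.B.obj A), IsUnit b)
    (hdeg : ∀ Ψ : Δ.ModelGlobalFrobenioid ≌ Δ.ModelGlobalFrobenioid,
      PreFrobenioidData.PreservesDegFr (ModelFrobenioid.data Δ.Φ Δ.B Δ.div) (ModelFrobenioid.data Δ.Φ Δ.B Δ.div) Ψ)
    (hrig : ∀ Ψ : Δ.ModelGlobalFrobenioid ≌ Δ.ModelGlobalFrobenioid, IsRigidFunctor (Ψ.functor ⋙ Δ.modelBase))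
    (hdivAut : ∀ Ψ : Δ.ModelGlobalFrobenioid ≌ Δ.ModelGlobalFrobenioid,
      Nonempty (Ψ.functor ⋙ Δ.modelBase ≅ Δ.modelBase) →
      ∃ (θ : (ModelFrobenioid.data Δ.Φ Δ.B Δ.div).DivisorMonoidIsoOverBase (ModelFrobenioid.data Δ.Φ Δ.B Δ.div) (𝟭 (BaseCat G)))
        (η' : Ψ.functor ⋙ Δ.modelBase ≅ Δ.modelBase),
        ∀ ⦃A B : Δ.ModelGlobalFrobenioid⦄ (φ : A ⟶ B),
          ModelFrobenioid.div (Ψ.functor.map φ) = pull Δ.Φ (η'.hom.app A) (θ.iso A.base (ModelFrobenioid.div φ)))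
    (hΦ : ∀ (A : BaseCat G) (θ : Δ.Φ.obj (op A) ≃* Δ.Φ.obj (op A)),
      (∀ w : Δ.B.obj (op A), MonGp.map θ.toMonoidHom (divB Δ.Φ Δ.B Δ.div (op A) w) = divB Δ.Φ Δ.B Δ.div (op A) w) →
      ∀ x, θ x = x)
    (hB : ∀ Ψ : Δ.ModelGlobalFrobenioid ≌ Δ.ModelGlobalFrobenioid,
      Nonempty (Ψ.functor ⋙ Δ.modelBase ≅ Δ.modelBase) →
      ∃ η : Ψ.functor ⋙ Δ.modelBase ≅ Δ.modelBase,
        ∀ ⦃X Y : Δ.ModelGlobalFrobenioid⦄ (f g : X ⟶ Y), ModelFrobenioid.degFr f = 1 →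
          ModelFrobenioid.degFr g = 1 → ModelFrobenioid.baseMap f = ModelFrobenioid.baseMap g →
            ModelFrobenioid.unit (Ψ.functor.map f) *
                pull Δ.B (A := X.base) (B := (Ψ.functor.obj X).base) (η.hom.app X)
                  (ModelFrobenioid.unit g) =
              ModelFrobenioid.unit (Ψ.functor.map g) *
                pull Δ.B (A := X.base) (B := (Ψ.functor.obj X).base) (η.hom.app X)
                  (ModelFrobenioid.unit f)) :
    Function.Injective (CatIsomorphism.descend he hu) :=
  CatIsomorphism.descend_injective_of_kernel_trivial he hu
    (model_rigidOverBase_of_divMonoidRigid_of_ratioRigid Δ hunits hdeg hrig hdivAut hΦ hB)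

/-- **[IUTchI] Cor 5.3 (i) AS PRINTED («bijective») at `ℱ(Δ)`**: `CatIsomorphism.DescendBijective` from the displayed inputs and
the surjectivity half `hlift` (FACT-policy, BY NAME). ([IUTchI] Cor 5.3 (i) p.144) [claim: Mochizuki2012, status: disputed] -/
theorem model_descendBijective_of_divMonoidRigid_of_ratioRigid_of_lifts
    (he : CatIsomorphism.HasUnder Δ.modelBase Δ.modelBase) (hu : CatIsomorphism.UnderUnique Δ.modelBase Δ.modelBase)
    (hunits : ∀ (A : (BaseCat G)ᵒᵖ) (b : Δ.B.obj A), IsUnit b)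
    (hdeg : ∀ Ψ : Δ.ModelGlobalFrobenioid ≌ Δ.ModelGlobalFrobenioid,
      PreFrobenioidData.PreservesDegFr (ModelFrobenioid.data Δ.Φ Δ.B Δ.div) (ModelFrobenioid.data Δ.Φ Δ.B Δ.div) Ψ)
    (hrig : ∀ Ψ : Δ.ModelGlobalFrobenioid ≌ Δ.ModelGlobalFrobenioid, IsRigidFunctor (Ψ.functor ⋙ Δ.modelBase))
    (hdivAut : ∀ Ψ : Δ.ModelGlobalFrobenioid ≌ Δ.ModelGlobalFrobenioid,
      Nonempty (Ψ.functor ⋙ Δ.modelBase ≅ Δ.modelBase) →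
      ∃ (θ : (ModelFrobenioid.data Δ.Φ Δ.B Δ.div).DivisorMonoidIsoOverBase (ModelFrobenioid.data Δ.Φ Δ.B Δ.div) (𝟭 (BaseCat G)))
        (η' : Ψ.functor ⋙ Δ.modelBase ≅ Δ.modelBase),
        ∀ ⦃A B : Δ.ModelGlobalFrobenioid⦄ (φ : A ⟶ B),
          ModelFrobenioid.div (Ψ.functor.map φ) = pull Δ.Φ (η'.hom.app A) (θ.iso A.base (ModelFrobenioid.div φ)))
    (hΦ : ∀ (A : BaseCat G) (θ : Δ.Φ.obj (op A) ≃* Δ.Φ.obj (op A)),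
      (∀ w : Δ.B.obj (op A), MonGp.map θ.toMonoidHom (divB Δ.Φ Δ.B Δ.div (op A) w) = divB Δ.Φ Δ.B Δ.div (op A) w) →
      ∀ x, θ x = x)
    (hB : ∀ Ψ : Δ.ModelGlobalFrobenioid ≌ Δ.ModelGlobalFrobenioid,
      Nonempty (Ψ.functor ⋙ Δ.modelBase ≅ Δ.modelBase) →
      ∃ η : Ψ.functor ⋙ Δ.modelBase ≅ Δ.modelBase,
        ∀ ⦃X Y : Δ.ModelGlobalFrobenioid⦄ (f g : X ⟶ Y), ModelFrobenioid.degFr f = 1 →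
          ModelFrobenioid.degFr g = 1 → ModelFrobenioid.baseMap f = ModelFrobenioid.baseMap g →
            ModelFrobenioid.unit (Ψ.functor.map f) *
                pull Δ.B (A := X.base) (B := (Ψ.functor.obj X).base) (η.hom.app X)
                  (ModelFrobenioid.unit g) =
              ModelFrobenioid.unit (Ψ.functor.map g) *
                pull Δ.B (A := X.base) (B := (Ψ.functor.obj X).base) (η.hom.app X)
                  (ModelFrobenioid.unit f))
    (hlift : ∀ Θ : BaseCat G ≌ BaseCat G, ∃ Ψ : Δ.ModelGlobalFrobenioid ≌ Δ.ModelGlobalFrobenioid,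
      Nonempty (CatIsomorphism.LiesUnder Δ.modelBase Δ.modelBase Ψ Θ)) :
    CatIsomorphism.DescendBijective Δ.modelBase Δ.modelBase he hu :=
  ⟨model_descend_injective_of_divMonoidRigid_of_ratioRigid Δ he hu hunits hdeg hrig hdivAut hΦ hB,
    CatIsomorphism.descend_surjective_of_lifts he hu hlift⟩

end Model

end Cor53

end Literature.IUT.HodgeTheaters

end
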